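import Literature.Computability.AlgebraicComplexity.InterfaceTensors
import HarnessLib

/-!
# One level down: half-chunks, one-level split distributions and products of split distributions
(Vassilevska Williams–Xu–Xu–Zhou 2024, §6 preamble: `γ̃_X`, eq. (14) `β_{W,t} = ∑ α_t (β_{W,t,i'j'k'} × β_{W,t,i_t−i',j_t−j',k_t−k'})`,
footnote 9 of the proof of Thm. 6.3) — proved

Topic `Literature/Computability/AlgebraicComplexity`.  The constituent stage (§6 of Vassilevska
Williams–Xu–Xu–Zhou, *New bounds for matrix multiplication: from alpha to omega*, SODA 2024,
arXiv:2307.07970) works one level below the input: a level-`ℓ` chunk of `2^{ℓ−1} = c + c` positions is a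
pair of level-`(ℓ−1)` half-chunks of `c = 2^{ℓ−2}` positions, "each level-`ℓ` index `i_t` splits into
two level-`(ℓ−1)` indices" `(l_X, r_X)`.  This file sets up that vocabulary for the tree's level-1
sequences (`Fin n → Fin (c+c) → Fin 3`, `InterfaceTensors.lean`) and PROVES the elementary facts the
proofs of Prop. 6.2 / Thm. 6.3 use about it:

* `leftHalf`, `rightHalf`, `halvesEquiv`, `patternLevel_eq_add` — a chunk shape is the pair of its
  half shapes; its level is the sum of the half levels;
* `halfChunks`, `mergeHalves`, `halfChunksEquiv`, `kroneckerPow_bigCw_mergeHalves`,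
  `tensorRestrictsTo_pow_halfChunks` / `tensorRestrictsTo_pow_mergeHalves` — the power
  `(CW_q^{⊗(c+c)})^{⊗n}` IS `(CW_q^{⊗c})^{⊗(n+n)}` read on half-chunks (restrictions both ways), so
  level-`(ℓ−1)` objects (zero-outs of the latter) live inside level-`ℓ` objects;
* `oneLevelSplit` — **`γ̃_X(l_X, r_X) = ∑_{left level l_X, right level r_X} γ_X(î)`** (§6 preamble),
  with `sum_oneLevelSplit` (total mass preserved);
* `splitProd` — **the product `β₁ × β₂`** of two level-`(ℓ−1)` split distributions (a level-`ℓ` split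
  distribution), `sum_splitProd` (masses multiply), `splitProd_nonneg/le_one`;
* `abs_splitProd_sub_le` — **footnote 9**: `‖ξ₁ × ξ₂ − β₁ × β₂‖_∞ ≤ ε₁ + ε₂` for `[0,1]`-valued
  factors with `‖ξ_i − β_i‖_∞ ≤ ε_i`;
* `splitMixture` — **eq. (14)**: `∑_{(i',j',k')} α(i',j',k') · (β_{i'j'k'} × β_{i−i',j−j',k−k'})`, with
  `abs_splitMixture_sub_le` — the mixture of `ε`-close families is `2ε`-close when `α ≥ 0`, `∑ α ≤ 1`
  ("since the coefficients `α_t^{(r)}(i',j',k')` sum up to 1, … `ξ_{W,t}^{(r)}` has at most `2ε`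
  distance from `β_{W,t}^{(r)}`").

Everything is proved; the definitions are the ones listed; no named facts.

## References

* V. Vassilevska Williams, Y. Xu, Z. Xu, R. Zhou, *New bounds for matrix multiplication: from alpha
  to omega*, SODA 2024, arXiv:2307.07970 (held: `paper:arxiv-2307.07970`), §6 (preamble: `γ̃`,
  eq. (14)), Thm. 6.3 (proof, footnote 9), §6.2 (level-`(ℓ−1)` index sequences as sequences of pairs).
  [VassilevskaWilliamsXuXuZhou2024]
-/

noncomputable section

open scoped BigOperators
open Finset

namespace Literature.Computability.AlgebraicComplexity

open Literature.Barriers.MatrixMultiplication (bigCwTensor)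

universe u

/-! ## Half-chunks -/

section Halves

variable {α : Type*} {c : ℕ}

/-- The left half of a chunk of `c + c` positions. [cite: VassilevskaWilliamsXuXuZhou2024, §6 (preamble: "î₁ + ⋯ + î_{2^{ℓ−2}} = l_X")] -/
def leftHalf (σ : Fin (c + c) → α) : Fin c → α := fun p => σ (Fin.castAdd c p)

/-- The right half of a chunk of `c + c` positions. [cite: VassilevskaWilliamsXuXuZhou2024, §6 (preamble: "î_{2^{ℓ−2}+1} + ⋯ + î_{2^{ℓ−1}} = r_X")] -/
def rightHalf (σ : Fin (c + c) → α) : Fin c → α := fun p => σ (Fin.natAdd c p)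

/-- Unfolding. [folklore] -/
@[simp] theorem leftHalf_apply (σ : Fin (c + c) → α) (p : Fin c) : leftHalf σ p = σ (Fin.castAdd c p) := rfl

/-- Unfolding. [folklore] -/
@[simp] theorem rightHalf_apply (σ : Fin (c + c) → α) (p : Fin c) : rightHalf σ p = σ (Fin.natAdd c p) := rfl

/-- A chunk is the concatenation of its halves. [folklore] -/
theorem append_leftHalf_rightHalf (σ : Fin (c + c) → α) : Fin.append (leftHalf σ) (rightHalf σ) = σ :=
  Fin.append_castAdd_natAdd

/-- Halves of a concatenation. [folklore] -/
@[simp] theorem leftHalf_append (a b : Fin c → α) : leftHalf (Fin.append a b) = a := by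
  funext p; simp only [leftHalf_apply, Fin.append_left]

/-- Halves of a concatenation. [folklore] -/
@[simp] theorem rightHalf_append (a b : Fin c → α) : rightHalf (Fin.append a b) = b := by
  funext p; simp only [rightHalf_apply, Fin.append_right]

/-- **A chunk shape is the pair of its half shapes** (an equivalence). [cite: VassilevskaWilliamsXuXuZhou2024, §6.2 ("viewed as a length-n_t {0,…,2^{ℓ−1}}²-sequence by combining pairs")] -/
def halvesEquiv : (Fin (c + c) → α) ≃ (Fin c → α) × (Fin c → α) where
  toFun σ := (leftHalf σ, rightHalf σ)
  invFun ab := Fin.append ab.1 ab.2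
  left_inv σ := append_leftHalf_rightHalf σ
  right_inv _ := Prod.ext (leftHalf_append _ _) (rightHalf_append _ _)

/-- **The level of a chunk is the sum of the levels of its halves.** [cite: VassilevskaWilliamsXuXuZhou2024, §6 (preamble)] -/
theorem patternLevel_eq_add (σ : Fin (c + c) → Fin 3) :
    patternLevel σ = patternLevel (leftHalf σ) + patternLevel (rightHalf σ) := by
  simp only [patternLevel, leftHalf, rightHalf]
  exact Fin.sum_univ_add _

end Halves

/-! ## The power read on half-chunks -/

section Power

variable {α : Type*} {c n : ℕ}

/-- **Level-1 data read on half-chunks**: position `u < n` is the left half of chunk `u`, position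
`n + u` its right half (any fixed bijection serves; the paper interleaves odd/even positions).
[cite: VassilevskaWilliamsXuXuZhou2024, §6.2 ("Each level-(ℓ−1) index sequence … the t-th part is a length-(2n_t) sequence")] -/
def halfChunks (x : Fin n → Fin (c + c) → α) : Fin (n + n) → Fin c → α :=
  Fin.append (fun u => leftHalf (x u)) (fun u => rightHalf (x u))

/-- The inverse re-indexing. [folklore] -/
def mergeHalves (y : Fin (n + n) → Fin c → α) : Fin n → Fin (c + c) → α :=
  fun u => Fin.append (y (Fin.castAdd n u)) (y (Fin.natAdd n u))

/-- Values on left halves. [folklore] -/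
@[simp] theorem halfChunks_castAdd (x : Fin n → Fin (c + c) → α) (u : Fin n) :
    halfChunks x (Fin.castAdd n u) = leftHalf (x u) := by simp only [halfChunks, Fin.append_left]

/-- Values on right halves. [folklore] -/
@[simp] theorem halfChunks_natAdd (x : Fin n → Fin (c + c) → α) (u : Fin n) :
    halfChunks x (Fin.natAdd n u) = rightHalf (x u) := by simp only [halfChunks, Fin.append_right]

/-- `mergeHalves ∘ halfChunks = id`. [folklore] -/
@[simp] theorem mergeHalves_halfChunks (x : Fin n → Fin (c + c) → α) : mergeHalves (halfChunks x) = x := by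
  funext u
  simp only [mergeHalves, halfChunks_castAdd, halfChunks_natAdd, append_leftHalf_rightHalf]

/-- `halfChunks ∘ mergeHalves = id`. [folklore] -/
@[simp] theorem halfChunks_mergeHalves (y : Fin (n + n) → Fin c → α) : halfChunks (mergeHalves y) = y := by
  funext v
  refine Fin.addCases (fun u => ?_) (fun u => ?_) v
  · rw [halfChunks_castAdd]; simp only [mergeHalves, leftHalf_append]
  · rw [halfChunks_natAdd]; simp only [mergeHalves, rightHalf_append]

/-- **The re-indexing equivalence** between level-1 data on `n` chunks of `c + c` positions and on
`n + n` half-chunks of `c` positions. [cite: VassilevskaWilliamsXuXuZhou2024, §6.2] -/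
def halfChunksEquiv : (Fin n → Fin (c + c) → α) ≃ (Fin (n + n) → Fin c → α) where
  toFun := halfChunks
  invFun := mergeHalves
  left_inv := mergeHalves_halfChunks
  right_inv := halfChunks_mergeHalves

variable (K : Type u) [CommSemiring K] (q : ℕ)

/-- **`(CW_q^{⊗(c+c)})^{⊗n}(x,y,z) = (CW_q^{⊗c})^{⊗(n+n)}` on the half-chunks.** [cite: VassilevskaWilliamsXuXuZhou2024, §6 (N = 2^{ℓ−1} n read at level ℓ−1)] -/
theorem kroneckerPow_bigCw_halfChunks (x y z : Fin n → Fin (c + c) → Fin (q + 2)) :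
    kroneckerPow (kroneckerPow (bigCwTensor K q) c) (n + n) (halfChunks x) (halfChunks y) (halfChunks z) =
      kroneckerPow (kroneckerPow (bigCwTensor K q) (c + c)) n x y z := by
  simp only [kroneckerPow_apply, Fin.prod_univ_add, halfChunks, Fin.append_left, Fin.append_right, leftHalf_apply,
    rightHalf_apply, prod_mul_distrib]

/-- The same identity read from the half-chunk side. [folklore] -/
theorem kroneckerPow_bigCw_mergeHalves (x y z : Fin (n + n) → Fin c → Fin (q + 2)) :
    kroneckerPow (kroneckerPow (bigCwTensor K q) (c + c)) n (mergeHalves x) (mergeHalves y) (mergeHalves z) =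
      kroneckerPow (kroneckerPow (bigCwTensor K q) c) (n + n) x y z := by
  rw [← kroneckerPow_bigCw_halfChunks K q, halfChunks_mergeHalves, halfChunks_mergeHalves, halfChunks_mergeHalves]

/-- **Transport of restrictions to the half-chunk indexing**: a zero-out (or any tensor) `S` below
`(CW_q^{⊗c})^{⊗(n+n)}` is, read on merged chunks, below `(CW_q^{⊗(c+c)})^{⊗n}`. [folklore] -/
theorem tensorRestrictsTo_pow_halfChunks {X' Y' Z' : Type*} [Fintype X'] [Fintype Y'] [Fintype Z']
    {S : X' → Y' → Z' → K}
    (h : TensorRestrictsTo (kroneckerPow (kroneckerPow (bigCwTensor K q) c) (n + n)) S) :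
    TensorRestrictsTo (kroneckerPow (kroneckerPow (bigCwTensor K q) (c + c)) n) S := by
  have e : kroneckerPow (kroneckerPow (bigCwTensor K q) c) (n + n) = fun x y z =>
      kroneckerPow (kroneckerPow (bigCwTensor K q) (c + c)) n (mergeHalves x) (mergeHalves y) (mergeHalves z) := by
    funext x y z; rw [kroneckerPow_bigCw_mergeHalves]
  have h0 : TensorRestrictsTo (kroneckerPow (kroneckerPow (bigCwTensor K q) (c + c)) n)
      (kroneckerPow (kroneckerPow (bigCwTensor K q) c) (n + n)) := by
    rw [e]; exact TensorRestrictsTo.comap _ _ _ _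
  exact h0.trans h

/-- … and conversely. [folklore] -/
theorem tensorRestrictsTo_pow_mergeHalves {X' Y' Z' : Type*} [Fintype X'] [Fintype Y'] [Fintype Z']
    {S : X' → Y' → Z' → K}
    (h : TensorRestrictsTo (kroneckerPow (kroneckerPow (bigCwTensor K q) (c + c)) n) S) :
    TensorRestrictsTo (kroneckerPow (kroneckerPow (bigCwTensor K q) c) (n + n)) S := by
  have e : kroneckerPow (kroneckerPow (bigCwTensor K q) (c + c)) n = fun x y z =>
      kroneckerPow (kroneckerPow (bigCwTensor K q) c) (n + n) (halfChunks x) (halfChunks y) (halfChunks z) := by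
    funext x y z; rw [kroneckerPow_bigCw_halfChunks]
  have h0 : TensorRestrictsTo (kroneckerPow (kroneckerPow (bigCwTensor K q) c) (n + n))
      (kroneckerPow (kroneckerPow (bigCwTensor K q) (c + c)) n) := by
    rw [e]; exact TensorRestrictsTo.comap _ _ _ _
  exact h0.trans h

/-- Level-1 sequences commute with the re-indexing. [folklore] -/
theorem levelSeq_halfChunks (x : Fin n → Fin (c + c) → Fin (q + 2)) :
    levelSeq (halfChunks x) = halfChunks (levelSeq x) := by
  funext v p
  refine Fin.addCases (fun u => ?_) (fun u => ?_) v
  · simp only [levelSeq_apply, halfChunks_castAdd, leftHalf_apply]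
  · simp only [levelSeq_apply, halfChunks_natAdd, rightHalf_apply]

end Power

/-! ## One-level split distributions, products and mixtures -/

section Splits

variable {c : ℕ}

/-- **The one-level split distribution `γ̃(l, r) = ∑_{left level l, right level r} γ(î)`** of a
level-`ℓ` complete split distribution: how a level-`ℓ` index splits into two level-`(ℓ−1)` indices.
[cite: VassilevskaWilliamsXuXuZhou2024, §6 (preamble, definition of γ̃_X)] -/
def oneLevelSplit (γ : (Fin (c + c) → Fin 3) → ℝ) : ℕ × ℕ → ℝ :=
  fun lr => ∑ σ : Fin (c + c) → Fin 3, if patternLevel (leftHalf σ) = lr.1 ∧ patternLevel (rightHalf σ) = lr.2 then γ σ else 0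

/-- `γ̃ ≥ 0` for `γ ≥ 0`. [folklore] -/
theorem oneLevelSplit_nonneg {γ : (Fin (c + c) → Fin 3) → ℝ} (hγ : ∀ σ, 0 ≤ γ σ) (lr : ℕ × ℕ) : 0 ≤ oneLevelSplit γ lr :=
  sum_nonneg fun σ _ => by split_ifs <;> [exact hγ σ; exact le_rfl]

/-- **The total mass is preserved**: `∑_{(l,r)} γ̃(l,r) = ∑ γ` over any finite set of pairs containing
all realised ones. [cite: VassilevskaWilliamsXuXuZhou2024, §6 (preamble)] -/
theorem sum_oneLevelSplit (γ : (Fin (c + c) → Fin 3) → ℝ) {P : Finset (ℕ × ℕ)}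
    (hP : ∀ σ : Fin (c + c) → Fin 3, (patternLevel (leftHalf σ), patternLevel (rightHalf σ)) ∈ P) :
    ∑ lr ∈ P, oneLevelSplit γ lr = ∑ σ, γ σ := by
  unfold oneLevelSplit
  rw [sum_comm]
  refine sum_congr rfl fun σ _ => ?_
  rw [sum_ite, sum_const_zero, add_zero]
  have : P.filter (fun lr => patternLevel (leftHalf σ) = lr.1 ∧ patternLevel (rightHalf σ) = lr.2) =
      {(patternLevel (leftHalf σ), patternLevel (rightHalf σ))} := by
    ext lr
    simp only [mem_filter, mem_singleton, Prod.ext_iff]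
    constructor
    · rintro ⟨-, h1, h2⟩; exact ⟨h1.symm, h2.symm⟩
    · rintro ⟨h1, h2⟩
      refine ⟨?_, h1.symm, h2.symm⟩
      have := hP σ
      rwa [show lr = (patternLevel (leftHalf σ), patternLevel (rightHalf σ)) from Prod.ext h1 h2]
  rw [this, sum_singleton]

/-- **The product `β₁ × β₂` of two level-`(ℓ−1)` complete split distributions**: the level-`ℓ` split
distribution `î ↦ β₁(left half) β₂(right half)`. [cite: VassilevskaWilliamsXuXuZhou2024, Prop. 6.2 (eq. (14): β_{W,t,i',j',k'} × β_{W,t,i_t−i',j_t−j',k_t−k'})] -/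
def splitProd (β₁ β₂ : (Fin c → Fin 3) → ℝ) : (Fin (c + c) → Fin 3) → ℝ :=
  fun σ => β₁ (leftHalf σ) * β₂ (rightHalf σ)

/-- Unfolding. [folklore] -/
theorem splitProd_apply (β₁ β₂ : (Fin c → Fin 3) → ℝ) (σ : Fin (c + c) → Fin 3) :
    splitProd β₁ β₂ σ = β₁ (leftHalf σ) * β₂ (rightHalf σ) := rfl

/-- On a concatenated shape. [folklore] -/
@[simp] theorem splitProd_append (β₁ β₂ : (Fin c → Fin 3) → ℝ) (a b : Fin c → Fin 3) :
    splitProd β₁ β₂ (Fin.append a b) = β₁ a * β₂ b := by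
  simp [splitProd]

/-- **Masses multiply**: `∑ (β₁ × β₂) = (∑ β₁)(∑ β₂)`. [folklore] -/
theorem sum_splitProd (β₁ β₂ : (Fin c → Fin 3) → ℝ) : ∑ σ, splitProd β₁ β₂ σ = (∑ a, β₁ a) * ∑ b, β₂ b := by
  rw [← Equiv.sum_comp (halvesEquiv (α := Fin 3) (c := c)).symm, Fintype.sum_prod_type, sum_mul_sum]
  refine sum_congr rfl fun a _ => sum_congr rfl fun b _ => ?_
  simp [halvesEquiv]

/-- `β₁ × β₂ ≥ 0`. [folklore] -/
theorem splitProd_nonneg {β₁ β₂ : (Fin c → Fin 3) → ℝ} (h₁ : ∀ a, 0 ≤ β₁ a) (h₂ : ∀ b, 0 ≤ β₂ b) (σ : Fin (c + c) → Fin 3) :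
    0 ≤ splitProd β₁ β₂ σ :=
  mul_nonneg (h₁ _) (h₂ _)

/-- `β₁ × β₂ ≤ 1` for `[0,1]`-valued factors. [folklore] -/
theorem splitProd_le_one {β₁ β₂ : (Fin c → Fin 3) → ℝ} (h₁ : ∀ a, 0 ≤ β₁ a) (h₁' : ∀ a, β₁ a ≤ 1)
    (h₂' : ∀ b, β₂ b ≤ 1) (σ : Fin (c + c) → Fin 3) : splitProd β₁ β₂ σ ≤ 1 := by
  unfold splitProd
  calc β₁ (leftHalf σ) * β₂ (rightHalf σ) ≤ β₁ (leftHalf σ) * 1 := mul_le_mul_of_nonneg_left (h₂' _) (h₁ _)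
    _ ≤ 1 := by rw [mul_one]; exact h₁' _

/-- **Footnote 9**: for `[0,1]`-valued `β₁, ξ₂` with `‖ξ₁ − β₁‖_∞ ≤ ε₁`, `‖ξ₂ − β₂‖_∞ ≤ ε₂`,
`‖ξ₁ × ξ₂ − β₁ × β₂‖_∞ ≤ ε₁ + ε₂` ("first, we change `β_{i'j'k'}` to `ξ_{i'j'k'}`, which introduces an
additive `ε` error …; then we change the second factor, which introduces another additive `ε` error").
[cite: VassilevskaWilliamsXuXuZhou2024, Thm. 6.3 (proof, footnote 9)] -/
theorem abs_splitProd_sub_le {β₁ β₂ ξ₁ ξ₂ : (Fin c → Fin 3) → ℝ} {ε₁ ε₂ : ℝ}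
    (hβ₁0 : ∀ a, 0 ≤ β₁ a) (hβ₁1 : ∀ a, β₁ a ≤ 1) (hξ₂0 : ∀ b, 0 ≤ ξ₂ b) (hξ₂1 : ∀ b, ξ₂ b ≤ 1)
    (h₁ : ∀ a, |ξ₁ a - β₁ a| ≤ ε₁) (h₂ : ∀ b, |ξ₂ b - β₂ b| ≤ ε₂) (σ : Fin (c + c) → Fin 3) :
    |splitProd ξ₁ ξ₂ σ - splitProd β₁ β₂ σ| ≤ ε₁ + ε₂ := by
  simp only [splitProd]
  set a := leftHalf σ
  set b := rightHalf σ
  have e : ξ₁ a * ξ₂ b - β₁ a * β₂ b = (ξ₁ a - β₁ a) * ξ₂ b + β₁ a * (ξ₂ b - β₂ b) := by ring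
  rw [e]
  refine (abs_add_le _ _).trans (add_le_add ?_ ?_)
  · rw [abs_mul, abs_of_nonneg (hξ₂0 b)]
    calc |ξ₁ a - β₁ a| * ξ₂ b ≤ ε₁ * ξ₂ b := mul_le_mul_of_nonneg_right (h₁ a) (hξ₂0 b)
      _ ≤ ε₁ * 1 := mul_le_mul_of_nonneg_left (hξ₂1 b) ((abs_nonneg _).trans (h₁ a))
      _ = ε₁ := mul_one _
  · rw [abs_mul, abs_of_nonneg (hβ₁0 a)]
    calc β₁ a * |ξ₂ b - β₂ b| ≤ β₁ a * ε₂ := mul_le_mul_of_nonneg_left (h₂ b) (hβ₁0 a)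
      _ ≤ 1 * ε₂ := mul_le_mul_of_nonneg_right (hβ₁1 a) ((abs_nonneg _).trans (h₂ b))
      _ = ε₂ := one_mul _

/-- **Eq. (14), the mixture of products**: `∑_{s ∈ S} α(s) · (β_s × β_{ijk − s})` (the level-`ℓ` split
distribution induced by `α_t` and the level-`(ℓ−1)` distributions `β_{W,t,i',j',k'}`; `S` = the
constituent triples `(i',j',k')` one level down, `ijk − s` componentwise). [cite: VassilevskaWilliamsXuXuZhou2024, Prop. 6.2 (fourth constraint) and eq. (14)] -/
def splitMixture (S : Finset (ℕ × ℕ × ℕ)) (α : ℕ × ℕ × ℕ → ℝ) (β : ℕ × ℕ × ℕ → (Fin c → Fin 3) → ℝ)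
    (ijk : ℕ × ℕ × ℕ) : (Fin (c + c) → Fin 3) → ℝ :=
  fun σ => ∑ s ∈ S, α s * splitProd (β s) (β (ijk.1 - s.1, ijk.2.1 - s.2.1, ijk.2.2 - s.2.2)) σ

/-- **The mixture of `ε`-close families is `2ε`-close** (`α ≥ 0`, `∑ α ≤ 1`, all distributions
`[0,1]`-valued): "since the coefficients `α_t^{(r)}(i',j',k')` sum up to 1, we know that the left-hand
side `ξ_{W,t}^{(r)}` has at most `2ε` distance from `β_{W,t}^{(r)}`". [cite: VassilevskaWilliamsXuXuZhou2024, Thm. 6.3 (proof)] -/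
theorem abs_splitMixture_sub_le {S : Finset (ℕ × ℕ × ℕ)} {α : ℕ × ℕ × ℕ → ℝ} (hα0 : ∀ s ∈ S, 0 ≤ α s)
    (hα1 : ∑ s ∈ S, α s ≤ 1) {β ξ : ℕ × ℕ × ℕ → (Fin c → Fin 3) → ℝ} (hβ0 : ∀ s a, 0 ≤ β s a)
    (hβ1 : ∀ s a, β s a ≤ 1) (hξ0 : ∀ s a, 0 ≤ ξ s a) (hξ1 : ∀ s a, ξ s a ≤ 1) {ε : ℝ} (hε : 0 ≤ ε)
    (hclose : ∀ s a, |ξ s a - β s a| ≤ ε) (ijk : ℕ × ℕ × ℕ) (σ : Fin (c + c) → Fin 3) :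
    |splitMixture S α ξ ijk σ - splitMixture S α β ijk σ| ≤ 2 * ε := by
  unfold splitMixture
  rw [← sum_sub_distrib]
  refine (abs_sum_le_sum_abs _ _).trans ?_
  calc ∑ s ∈ S, |α s * splitProd (ξ s) (ξ (ijk.1 - s.1, ijk.2.1 - s.2.1, ijk.2.2 - s.2.2)) σ -
          α s * splitProd (β s) (β (ijk.1 - s.1, ijk.2.1 - s.2.1, ijk.2.2 - s.2.2)) σ|
      ≤ ∑ s ∈ S, α s * (ε + ε) := by
        refine sum_le_sum fun s hs => ?_
        rw [← mul_sub, abs_mul, abs_of_nonneg (hα0 s hs)]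
        exact mul_le_mul_of_nonneg_left
          (abs_splitProd_sub_le (hβ0 s) (hβ1 s) (hξ0 _) (hξ1 _) (hclose s) (hclose _) σ) (hα0 s hs)
    _ = ∑ s ∈ S, α s * (2 * ε) := sum_congr rfl fun s _ => by ring
    _ = (∑ s ∈ S, α s) * (2 * ε) := by rw [sum_mul]
    _ ≤ 1 * (2 * ε) := mul_le_mul_of_nonneg_right hα1 (by linarith)
    _ = 2 * ε := one_mul _

/-- Masses of the mixture: `∑_σ mixture = ∑_s α(s) (∑ β_s)(∑ β_{ijk−s})` (so a mixture of products of
distributions with weights summing to `1` is a distribution). [cite: VassilevskaWilliamsXuXuZhou2024, Prop. 6.2 (constraints)] -/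
theorem sum_splitMixture (S : Finset (ℕ × ℕ × ℕ)) (α : ℕ × ℕ × ℕ → ℝ) (β : ℕ × ℕ × ℕ → (Fin c → Fin 3) → ℝ)
    (ijk : ℕ × ℕ × ℕ) :
    ∑ σ, splitMixture S α β ijk σ =
      ∑ s ∈ S, α s * ((∑ a, β s a) * ∑ b, β (ijk.1 - s.1, ijk.2.1 - s.2.1, ijk.2.2 - s.2.2) b) := by
  unfold splitMixture
  rw [sum_comm]
  refine sum_congr rfl fun s _ => ?_
  rw [← mul_sum, sum_splitProd]

end Splits

end Literature.Computability.AlgebraicComplexity
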